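import Summits.AnomalousDissipation.AnomalousDissipation.Theses.KolmogorovPincer
import Summits.AnomalousDissipation.AnomalousDissipation.Theorems.KolmogorovPincerIncrementPincerTG
import Literature.Analysis.FluidPDE.DoeringFoiasProofs
import Literature.Analysis.FluidPDE.DoeringFoiasPowerProofs
import Literature.Analysis.FluidPDE.LerayHopfSpectralMeasurability
import Literature.Analysis.FluidPDE.AlexakisDoeringInterpolation
import Literature.Analysis.FluidPDE.NSHopfEnergy
import Literature.Analysis.FunctionSpaces.BesovDifference
import Literature.Analysis.FunctionSpaces.TorusSobolevL6Spectral
import Literature.Analysis.FunctionSpaces.FlatTorus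

/-!
# Tools for the support item `KolmogorovPincer.KnownGradeRungTG` (stmt-AnomalousDissipation-32781)

Route `KolmogorovPincer` (decomp-ad cell), Y-jaw ladder, RUNG 0 = the KNOWN grade `7/8`.  This file holds
the slice estimates the rung is made of (helpers landed `--supports` the item; the item itself is closed
by `Theorems/KolmogorovPincerKnownGradeRungTG.lean`):
* same-function interpolation `‖g‖_{8/3} ≤ ‖g‖₂^{5/8}‖g‖₆^{3/8}` and `‖δ_h v‖_p ≤ 2‖v‖_p` on `T³`;
* the CEILING-JAW slice bound `[v]_{B^{1/2}_{8/3,∞}} ≤ [v]_{B¹_{2,∞}}^{1/2}(2‖v‖₂)^{1/8}(2‖v‖₆)^{3/8}`,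
  hence with the `H¹` corner (`[v]_{B¹_{2,∞}} ≤ √3‖∇v‖₂`, from the increment-pincer file)
  `[v]⁸ ≤ (3‖∇v‖²)²(2‖v‖₂)(2‖v‖₆)³`, and its real LINEARISED form for `ν ≤ 1`:
  `ν^{7/8}[v]² ≤ 4(K+1)(ν‖∇v‖₂² + ‖v‖₂²)`, `K` = the `H¹(T³) ⊂ L⁶` constant
  (tree `Torus.exists_eLpNorm_six_le_eSobolevNorm_one`);
* two folklore Leray–Hopf facts: `‖∇u(t)‖₂ < ∞` for a.e. `t > 0`, and the from-rest dissipation-mean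
  bound `⟨ν‖∇u‖²⟩_T ≤ ‖f‖₂ ⟨‖u‖₂²⟩_T^{1/2}` (Doering–Foias 2002 §2).
Ported by name from the decomp-ad lens-1 g14/g15 node files (`CeilingLadder.lean` v2, `KolmogorovLagCut.lean`,
kernel-checked 2026-08-30).  Nothing here proves the summit or either jaw.
References: Triebel 1983 §2.5.12 (Nikol'skii spaces); DiPerna–Lions 1989 Lemma II.1; Doering–Foias 2002 §2. [folklore]
-/

set_option linter.dupNamespace false

noncomputable section

namespace Summit.AnomalousDissipation.AnomalousDissipation.Theorems.KolmogorovPincerKnownGradeRungTGTools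

open scoped BigOperators Topology Classical MeasureTheory InnerProductSpace
open Filter Set Function TopologicalSpace MeasureTheory
open scoped ENNReal
open Literature.Analysis.FunctionSpaces Literature.Analysis.FluidPDE
open Summit.AnomalousDissipation.AnomalousDissipation.Theses
open Summit.AnomalousDissipation.AnomalousDissipation.Theorems.KolmogorovPincerIncrementPincerTG
  (eBesovSupSeminorm_one_two_le_sqrt_three)

/-! ## Folklore Leray–Hopf slice facts -/

/-- `‖∇u(t)‖₂ < ∞` for a.e. `t > 0` along a global Leray–Hopf solution. [folklore] -/
theorem ae_eGradNormSq_lt_top_Ioi {ν : ℝ} {F : ℝ → UnitAddTorus (Fin 3) → EuclideanSpace ℝ (Fin 3)}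
    {u₀ : UnitAddTorus (Fin 3) → EuclideanSpace ℝ (Fin 3)}
    {u : ℝ → UnitAddTorus (Fin 3) → EuclideanSpace ℝ (Fin 3)} (hu : Torus.IsGlobalLerayHopf ν F u₀ u) :
    ∀ᵐ t ∂(volume.restrict (Set.Ioi (0 : ℝ))), Torus.eGradNormSq (u t) < ⊤ := by
  rw [Torus.Ioi_zero_eq_iUnion_Ioo_nat, ae_restrict_iUnion_iff]
  intro n
  rcases Nat.eq_zero_or_pos n with hn | hn
  · subst hn; simp
  · have hLH := hu n (by exact_mod_cast hn)
    exact ae_lt_top' hLH.aemeasurable_eGradNormSq hLH.lintegral_eGradNormSq_lt_top.ne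

/-- **Uniform-in-ν dissipation-mean bound from rest**: `⟨D⟩_T ≤ ‖f‖₂ · ⟨‖u‖₂²⟩_T^{1/2}` for every
`T > 0` (energy inequality from rest + Cauchy–Schwarz/Jensen on the power; Doering–Foias 2002 §2). -/
theorem timeMean_dissipation_le_of_rest {ν : ℝ} {f : UnitAddTorus (Fin 3) → EuclideanSpace ℝ (Fin 3)}
    {u : ℝ → UnitAddTorus (Fin 3) → EuclideanSpace ℝ (Fin 3)} (hfs : Torus.IsSmooth f)
    (hu : Torus.IsGlobalLerayHopf ν (fun _ => f) 0 u) {T : ℝ} (hT : 0 < T) :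
    timeMean (fun t => ν * (Torus.eGradNormSq (u t)).toReal) T ≤
      Real.sqrt (∫ x, ‖f x‖ ^ 2) * Real.sqrt (timeMean (fun t => ∫ x, ‖u t x‖ ^ 2) T) := by
  have hKE : Torus.kineticEnergy (0 : UnitAddTorus (Fin 3) → EuclideanSpace ℝ (Fin 3)) = 0 := by
    simp [Torus.kineticEnergy]
  have h1 := (hu T hT).intervalIntegral_dissipation_le hT
  rw [hKE, zero_add] at h1
  have h2 : timeMean (fun t => ν * (Torus.eGradNormSq (u t)).toReal) T ≤
      timeMean (fun t => ∫ x, ⟪f x, u t x⟫_ℝ) T := by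
    unfold timeMean
    exact mul_le_mul_of_nonneg_left h1 (inv_nonneg.2 hT.le)
  exact h2.trans ((le_abs_self _).trans (hu.abs_timeMean_power_le hfs hT))

/-! ## Slice estimates of rung 0 -/


/-- `‖v(· + h) − v‖_p ≤ 2‖v‖_p` on the torus (`p ≥ 1`; translation invariance of Haar measure). [folklore] -/
theorem eLpNorm_sub_translate_le_two_mul {E : Type*} [NormedAddCommGroup E]
    {v : UnitAddTorus (Fin 3) → E} (hv : AEStronglyMeasurable v volume) (h : UnitAddTorus (Fin 3))
    {p : ℝ≥0∞} (hp : 1 ≤ p) :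
    eLpNorm (fun x => v (x + h) - v x) p volume ≤ 2 * eLpNorm v p volume := by
  have h1 : eLpNorm (fun x => v (x + h)) p volume = eLpNorm v p volume :=
    eLpNorm_comp_measurePreserving (f := fun x : UnitAddTorus (Fin 3) => x + h) hv
      (measurePreserving_add_right volume h)
  calc eLpNorm (fun x => v (x + h) - v x) p volume
      ≤ eLpNorm (fun x => v (x + h)) p volume + eLpNorm v p volume :=
        eLpNorm_sub_le (hv.comp_measurePreserving (measurePreserving_add_right volume h)) hv hp
    _ = 2 * eLpNorm v p volume := by rw [h1, two_mul]


/-- Helper `rpow_split_83_26` (docstring added at landing, census g17 — gate `lint.docstring`; statement and proof unchanged). -/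
private lemma rpow_split_83_26 (x : ℝ≥0∞) :
    x ^ (8 / 3 : ℝ) = (x ^ (2 : ℝ)) ^ (5 / 6 : ℝ) * (x ^ (6 : ℝ)) ^ (1 / 6 : ℝ) := by
  rw [← ENNReal.rpow_mul, ← ENNReal.rpow_mul,
    ← ENNReal.rpow_add_of_nonneg _ _ (by norm_num) (by norm_num)]
  norm_num

/-- Hölder form: `∫ |g|^{8/3} ≤ (∫ |g|²)^{5/6} (∫ |g|⁶)^{1/6}`. [folklore] -/
theorem lintegral_rpow_eight_thirds_le_two_six {α : Type*} [MeasurableSpace α] {μ : Measure α}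
    {G : Type*} [NormedAddCommGroup G] {g : α → G} (hg : AEStronglyMeasurable g μ) :
    ∫⁻ a, ‖g a‖ₑ ^ (8 / 3 : ℝ) ∂μ ≤
      (∫⁻ a, ‖g a‖ₑ ^ (2 : ℝ) ∂μ) ^ (5 / 6 : ℝ) * (∫⁻ a, ‖g a‖ₑ ^ (6 : ℝ) ∂μ) ^ (1 / 6 : ℝ) := by
  have h := ENNReal.lintegral_mul_norm_pow_le (μ := μ) (f := fun a => ‖g a‖ₑ ^ (2 : ℝ))
    (g := fun a => ‖g a‖ₑ ^ (6 : ℝ)) (hg.enorm.pow_const _) (hg.enorm.pow_const _)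
    (p := 5 / 6) (q := 1 / 6) (by norm_num) (by norm_num) (by norm_num)
  simp_rw [rpow_split_83_26]
  exact h

/-- **Same-function interpolation** `‖g‖_{8/3} ≤ ‖g‖₂^{5/8} ‖g‖₆^{3/8}`
(`3/8 = (5/8)·½ + (3/8)·⅙`). [folklore] -/
theorem eLpNorm_eight_thirds_le_two_six {α : Type*} [MeasurableSpace α] {μ : Measure α}
    {G : Type*} [NormedAddCommGroup G] {g : α → G} (hg : AEStronglyMeasurable g μ) :
    eLpNorm g (8 / 3 : ℝ≥0∞) μ ≤
      eLpNorm g 2 μ ^ (5 / 8 : ℝ) * eLpNorm g 6 μ ^ (3 / 8 : ℝ) := by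
  have h83_0 : (8 / 3 : ℝ≥0∞) ≠ 0 := by simp
  have h83_t : (8 / 3 : ℝ≥0∞) ≠ ⊤ := by simp [ENNReal.div_eq_top]
  have t83 : (8 / 3 : ℝ≥0∞).toReal = 8 / 3 := by rw [ENNReal.toReal_div]; norm_num
  have h6_0 : (6 : ℝ≥0∞) ≠ 0 := by norm_num
  have h6_t : (6 : ℝ≥0∞) ≠ ⊤ := ENNReal.ofNat_ne_top
  rw [eLpNorm_eq_lintegral_rpow_enorm_toReal h83_0 h83_t,
    eLpNorm_eq_lintegral_rpow_enorm_toReal two_ne_zero ENNReal.ofNat_ne_top,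
    eLpNorm_eq_lintegral_rpow_enorm_toReal h6_0 h6_t, t83, ENNReal.toReal_ofNat, ENNReal.toReal_ofNat]
  have h := lintegral_rpow_eight_thirds_le_two_six (μ := μ) hg
  calc (∫⁻ a, ‖g a‖ₑ ^ (8 / 3 : ℝ) ∂μ) ^ (1 / (8 / 3 : ℝ))
      ≤ ((∫⁻ a, ‖g a‖ₑ ^ (2 : ℝ) ∂μ) ^ (5 / 6 : ℝ) *
          (∫⁻ a, ‖g a‖ₑ ^ (6 : ℝ) ∂μ) ^ (1 / 6 : ℝ)) ^ (1 / (8 / 3 : ℝ)) :=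
        ENNReal.rpow_le_rpow h (by norm_num)
    _ = ((∫⁻ a, ‖g a‖ₑ ^ (2 : ℝ) ∂μ) ^ (1 / (2 : ℝ))) ^ (5 / 8 : ℝ) *
          ((∫⁻ a, ‖g a‖ₑ ^ (6 : ℝ) ∂μ) ^ (1 / (6 : ℝ))) ^ (3 / 8 : ℝ) := by
        rw [ENNReal.mul_rpow_of_nonneg _ _ (by norm_num), ← ENNReal.rpow_mul, ← ENNReal.rpow_mul,
          ← ENNReal.rpow_mul, ← ENNReal.rpow_mul]
        norm_num

/-- `(eLpNorm f 2 μ)² ≤ ∫⁻ ‖f‖ₑ²` (in fact an equality). [folklore] -/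
theorem eLpNorm_two_sq_le_lintegral {α : Type*} [MeasurableSpace α] {μ : Measure α}
    {G : Type*} [NormedAddCommGroup G] (f : α → G) : eLpNorm f 2 μ ^ 2 ≤ ∫⁻ x, ‖f x‖ₑ ^ 2 ∂μ := by
  have h1 : eLpNorm f 2 μ = (∫⁻ x, ‖f x‖ₑ ^ 2 ∂μ) ^ (1 / 2 : ℝ) := by
    rw [eLpNorm_eq_lintegral_rpow_enorm_toReal (by norm_num) (by norm_num)]
    simp only [ENNReal.toReal_ofNat, ENNReal.rpow_ofNat]
  rw [h1, ← ENNReal.rpow_natCast _ 2, ← ENNReal.rpow_mul]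
  norm_num

/-- **Ceiling jaw with `L⁶`**:
`[v]_{B^{1/2}_{8/3,∞}} ≤ [v]_{B^1_{2,∞}}^{1/2} · (2‖v‖₂)^{1/8} · (2‖v‖₆)^{3/8}`. [folklore] -/
theorem eBesovSupSeminorm_half_le_lsix {v : UnitAddTorus (Fin 3) → EuclideanSpace ℝ (Fin 3)}
    (hv : AEStronglyMeasurable v volume) :
    eBesovSupSeminorm (1 / 2 : ℝ) (8 / 3 : ℝ≥0∞) v volume ≤
      eBesovSupSeminorm 1 2 v volume ^ (1 / 2 : ℝ) * (2 * eLpNorm v 2 volume) ^ (1 / 8 : ℝ) *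
        (2 * eLpNorm v 6 volume) ^ (3 / 8 : ℝ) := by
  set N₁ := eBesovSupSeminorm 1 2 v volume with hN₁
  rw [eBesovSupSeminorm_def]
  refine iSup₂_le fun h hh => ?_
  have hpos : 0 < ‖h‖ := norm_pos_iff.2 hh
  rw [ENNReal.div_le_iff (ofReal_norm_rpow_pos _ hh).ne' ENNReal.ofReal_ne_top]
  have hg : AEStronglyMeasurable (fun x => v (x + h) - v x) volume :=
    (aestronglyMeasurable_comp_add_right hv h).sub hv
  have h2 : eLpNorm (fun x => v (x + h) - v x) 2 volume ≤ N₁ * ENNReal.ofReal (‖h‖ ^ (1 : ℝ)) :=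
    eLpNorm_sub_le_eBesovSupSeminorm_mul hh
  have h2' : eLpNorm (fun x => v (x + h) - v x) 2 volume ≤ 2 * eLpNorm v 2 volume :=
    eLpNorm_sub_translate_le_two_mul hv h (by norm_num)
  have h6' : eLpNorm (fun x => v (x + h) - v x) 6 volume ≤ 2 * eLpNorm v 6 volume :=
    eLpNorm_sub_translate_le_two_mul hv h (by norm_num)
  calc eLpNorm (fun x => v (x + h) - v x) (8 / 3 : ℝ≥0∞) volume
      ≤ eLpNorm (fun x => v (x + h) - v x) 2 volume ^ (5 / 8 : ℝ) *
          eLpNorm (fun x => v (x + h) - v x) 6 volume ^ (3 / 8 : ℝ) :=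
        eLpNorm_eight_thirds_le_two_six hg
    _ = eLpNorm (fun x => v (x + h) - v x) 2 volume ^ (1 / 2 : ℝ) *
          eLpNorm (fun x => v (x + h) - v x) 2 volume ^ (1 / 8 : ℝ) *
          eLpNorm (fun x => v (x + h) - v x) 6 volume ^ (3 / 8 : ℝ) := by
        rw [← ENNReal.rpow_add_of_nonneg _ _ (by norm_num) (by norm_num)]; norm_num
    _ ≤ (N₁ * ENNReal.ofReal (‖h‖ ^ (1 : ℝ))) ^ (1 / 2 : ℝ) * (2 * eLpNorm v 2 volume) ^ (1 / 8 : ℝ) *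
          (2 * eLpNorm v 6 volume) ^ (3 / 8 : ℝ) := by
        gcongr
    _ = N₁ ^ (1 / 2 : ℝ) * (2 * eLpNorm v 2 volume) ^ (1 / 8 : ℝ) * (2 * eLpNorm v 6 volume) ^ (3 / 8 : ℝ) *
          ENNReal.ofReal (‖h‖ ^ (1 / 2 : ℝ)) := by
        rw [ENNReal.mul_rpow_of_nonneg _ _ (by norm_num),
          ENNReal.ofReal_rpow_of_nonneg (by positivity) (by norm_num), ← Real.rpow_mul hpos.le]
        norm_num
        ring

/-- ENNReal core of rung 0: `[v]⁸_{B^{1/2}_{8/3,∞}} ≤ (3‖∇v‖²)² · (2‖v‖₂) · (2‖v‖₆)³`. -/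
theorem eBesovSupSeminorm_half_pow_eight_le_lsix {v : UnitAddTorus (Fin 3) → EuclideanSpace ℝ (Fin 3)}
    (hv : MemLp v 2 volume) :
    eBesovSupSeminorm (1 / 2 : ℝ) (8 / 3 : ℝ≥0∞) v volume ^ 8 ≤
      (3 * Torus.eGradNormSq v) ^ 2 * (2 * eLpNorm v 2 volume) * (2 * eLpNorm v 6 volume) ^ 3 := by
  set NC := eBesovSupSeminorm (1 / 2 : ℝ) (8 / 3 : ℝ≥0∞) v volume
  set N₁ := eBesovSupSeminorm 1 2 v volume
  set G := Torus.eGradNormSq v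
  set S₂ := eLpNorm v 2 volume
  set S₆ := eLpNorm v 6 volume
  have hB := eBesovSupSeminorm_half_le_lsix hv.aestronglyMeasurable
  have h1 : N₁ ≤ ENNReal.ofReal (Real.sqrt 3) * G ^ (1 / 2 : ℝ) :=
    eBesovSupSeminorm_one_two_le_sqrt_three hv
  have h2 : N₁ ^ 2 ≤ 3 * G := by
    calc N₁ ^ 2 ≤ (ENNReal.ofReal (Real.sqrt 3) * G ^ (1 / 2 : ℝ)) ^ 2 := by gcongr
      _ = ENNReal.ofReal (Real.sqrt 3) ^ 2 * (G ^ (1 / 2 : ℝ)) ^ 2 := mul_pow _ _ _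
      _ = 3 * G := by
          rw [← ENNReal.ofReal_pow (Real.sqrt_nonneg _), Real.sq_sqrt (by norm_num : (0:ℝ) ≤ 3),
            ← ENNReal.rpow_two (G ^ (1 / 2 : ℝ)), ← ENNReal.rpow_mul, ENNReal.ofReal_ofNat]
          norm_num
  have h3 : NC ^ 8 ≤ N₁ ^ 4 * (2 * S₂) * (2 * S₆) ^ 3 := by
    calc NC ^ 8 ≤ (N₁ ^ (1 / 2 : ℝ) * (2 * S₂) ^ (1 / 8 : ℝ) * (2 * S₆) ^ (3 / 8 : ℝ)) ^ 8 := by gcongr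
      _ = N₁ ^ 4 * (2 * S₂) * (2 * S₆) ^ 3 := by
          rw [mul_pow, mul_pow, ← ENNReal.rpow_natCast (N₁ ^ (1 / 2 : ℝ)),
            ← ENNReal.rpow_natCast ((2 * S₂) ^ (1 / 8 : ℝ)), ← ENNReal.rpow_natCast ((2 * S₆) ^ (3 / 8 : ℝ)),
            ← ENNReal.rpow_mul, ← ENNReal.rpow_mul, ← ENNReal.rpow_mul, ← ENNReal.rpow_natCast N₁,
            ← ENNReal.rpow_natCast (2 * S₆)]
          norm_num
  calc NC ^ 8 ≤ N₁ ^ 4 * (2 * S₂) * (2 * S₆) ^ 3 := h3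
    _ = (N₁ ^ 2) ^ 2 * (2 * S₂) * (2 * S₆) ^ 3 := by ring
    _ ≤ (3 * G) ^ 2 * (2 * S₂) * (2 * S₆) ^ 3 := by gcongr

/-- Real, LINEARISED form of rung 0 at a time slice with `ν ≤ 1`:
`ν^{7/8}[v]²_{B^{1/2}_{8/3,∞}} ≤ 4(K+1)·(ν‖∇v‖₂² + ‖v‖₂²)`, `K` = the `H¹ ⊂ L⁶` constant of `T³`
(`[v]⁸ ≤ 144‖∇v‖⁴‖v‖₂‖v‖₆³`, `‖v‖₆ ≤ K‖v‖_{H¹}`, `‖v‖²_{H¹} ≤ ‖v‖₂² + ‖∇v‖₂²`, then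
`ν⁷‖∇v‖⁴‖v‖₂²‖v‖₆⁶ ≤ K⁶ (ν‖∇v‖² + ‖v‖²)⁸` for `ν ≤ 1`). -/
theorem seven_eighths_le_real {ν : ℝ} (hν : 0 < ν) (hν1 : ν ≤ 1) {K : NNReal}
    {v : UnitAddTorus (Fin 3) → EuclideanSpace ℝ (Fin 3)} (hv : MemLp v 2 volume)
    (hG : Torus.eGradNormSq v < ⊤)
    (hH : Torus.eSobolevNorm 1 (EuclideanSpace.complexify ∘ v) < ⊤)
    (hK : eLpNorm v 6 volume ≤ K * Torus.eSobolevNorm 1 (EuclideanSpace.complexify ∘ v)) :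
    ν ^ (7 / 8 : ℝ) * ((eBesovSupSeminorm (1 / 2 : ℝ) (8 / 3 : ENNReal) v volume) ^ 2).toReal ≤
      4 * ((K : ℝ) + 1) * (ν * (Torus.eGradNormSq v).toReal + ∫ x, ‖v x‖ ^ 2) := by
  have key := eBesovSupSeminorm_half_pow_eight_le_lsix hv
  have hHsq := Torus.eSobolevNorm_one_complexify_sq_le hv
  have hL2 : (∫⁻ x, ‖v x‖ₑ ^ 2) = ENNReal.ofReal (∫ x, ‖v x‖ ^ 2) := lintegral_enorm_sq_eq_ofReal hv
  rw [hL2] at hHsq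
  have hS₂sq : eLpNorm v 2 volume ^ 2 ≤ ENNReal.ofReal (∫ x, ‖v x‖ ^ 2) := by
    rw [← hL2]; exact eLpNorm_two_sq_le_lintegral v
  set NC := eBesovSupSeminorm (1 / 2 : ℝ) (8 / 3 : ENNReal) v volume
  set G := Torus.eGradNormSq v
  set S₂ := eLpNorm v 2 volume
  set S₆ := eLpNorm v 6 volume
  set H := Torus.eSobolevNorm 1 (EuclideanSpace.complexify ∘ v)
  set e : ℝ := ∫ x, ‖v x‖ ^ 2
  have he0 : 0 ≤ e := integral_nonneg fun x => by positivity
  have hS₂ : S₂ < ⊤ := hv.eLpNorm_lt_top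
  have hS₆ : S₆ < ⊤ := lt_of_le_of_lt hK (ENNReal.mul_lt_top ENNReal.coe_lt_top hH)
  -- pass to real numbers
  have r1 : NC.toReal ^ 8 ≤ (3 * G.toReal) ^ 2 * (2 * S₂.toReal) * (2 * S₆.toReal) ^ 3 := by
    have hfin : (3 * G) ^ 2 * (2 * S₂) * (2 * S₆) ^ 3 ≠ ⊤ :=
      ENNReal.mul_ne_top (ENNReal.mul_ne_top (ENNReal.pow_ne_top (ENNReal.mul_ne_top (by norm_num) hG.ne))
        (ENNReal.mul_ne_top (by norm_num) hS₂.ne)) (ENNReal.pow_ne_top (ENNReal.mul_ne_top (by norm_num) hS₆.ne))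
    have := ENNReal.toReal_mono hfin key
    simpa only [ENNReal.toReal_mul, ENNReal.toReal_pow, ENNReal.toReal_ofNat] using this
  have r2 : S₆.toReal ≤ (K : ℝ) * H.toReal := by
    have := ENNReal.toReal_mono (ENNReal.mul_ne_top ENNReal.coe_ne_top hH.ne) hK
    rwa [ENNReal.toReal_mul, ENNReal.coe_toReal] at this
  have r3 : H.toReal ^ 2 ≤ e + G.toReal := by
    have hfin : ENNReal.ofReal e + G ≠ ⊤ := ENNReal.add_ne_top.2 ⟨ENNReal.ofReal_ne_top, hG.ne⟩
    have := ENNReal.toReal_mono hfin hHsq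
    rwa [ENNReal.toReal_pow, ENNReal.toReal_add ENNReal.ofReal_ne_top hG.ne,
      ENNReal.toReal_ofReal he0] at this
  have r4 : S₂.toReal ^ 2 ≤ e := by
    have := ENNReal.toReal_mono ENNReal.ofReal_ne_top hS₂sq
    rwa [ENNReal.toReal_pow, ENNReal.toReal_ofReal he0] at this
  rw [ENNReal.toReal_pow NC 2]
  set n := NC.toReal
  set g := G.toReal
  set s₂ := S₂.toReal
  set s₆ := S₆.toReal
  set hh := H.toReal
  have hn0 : 0 ≤ n := ENNReal.toReal_nonneg
  have hg0 : 0 ≤ g := ENNReal.toReal_nonneg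
  have hs20 : 0 ≤ s₂ := ENNReal.toReal_nonneg
  have hs60 : 0 ≤ s₆ := ENNReal.toReal_nonneg
  have hh0 : 0 ≤ hh := ENNReal.toReal_nonneg
  have hK0 : 0 ≤ (K : ℝ) := K.coe_nonneg
  have hn8 : n ^ 8 ≤ 144 * g ^ 2 * s₂ * s₆ ^ 3 := by
    calc n ^ 8 ≤ (3 * g) ^ 2 * (2 * s₂) * (2 * s₆) ^ 3 := r1
      _ = 144 * g ^ 2 * s₂ * s₆ ^ 3 := by ring
  have hs6 : s₆ ^ 6 ≤ (K : ℝ) ^ 6 * (e + g) ^ 3 := by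
    calc s₆ ^ 6 ≤ ((K : ℝ) * hh) ^ 6 := pow_le_pow_left₀ hs60 r2 6
      _ = (K : ℝ) ^ 6 * (hh ^ 2) ^ 3 := by ring
      _ ≤ (K : ℝ) ^ 6 * (e + g) ^ 3 := by gcongr
  have ha1 : ν * g ≤ e + ν * g := by linarith
  have ha2 : e ≤ e + ν * g := by nlinarith
  have ha3 : ν * e ≤ e := mul_le_of_le_one_left he0 hν1
  have hK6 : (K : ℝ) ^ 6 ≤ ((K : ℝ) + 1) ^ 8 :=
    calc (K : ℝ) ^ 6 ≤ ((K : ℝ) + 1) ^ 6 := pow_le_pow_left₀ hK0 (by linarith) 6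
      _ ≤ ((K : ℝ) + 1) ^ 8 := pow_le_pow_right₀ (by linarith) (by norm_num)
  have hν78 : (ν ^ (7 / 8 : ℝ)) ^ 8 = ν ^ 7 := by
    rw [← Real.rpow_natCast (ν ^ (7 / 8 : ℝ)) 8, ← Real.rpow_mul hν.le]; norm_num
  have hmain : (ν ^ (7 / 8 : ℝ) * n ^ 2) ^ 8 ≤ (4 * ((K : ℝ) + 1) * (ν * g + e)) ^ 8 := by
    calc (ν ^ (7 / 8 : ℝ) * n ^ 2) ^ 8 = ν ^ 7 * (n ^ 8) ^ 2 := by rw [mul_pow, hν78]; ring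
      _ ≤ ν ^ 7 * (144 * g ^ 2 * s₂ * s₆ ^ 3) ^ 2 := by gcongr
      _ = 144 ^ 2 * (ν * g) ^ 4 * s₂ ^ 2 * (ν ^ 3 * s₆ ^ 6) := by ring
      _ ≤ 144 ^ 2 * (ν * g) ^ 4 * e * (ν ^ 3 * ((K : ℝ) ^ 6 * (e + g) ^ 3)) := by
          gcongr
      _ = 144 ^ 2 * (K : ℝ) ^ 6 * ((ν * g) ^ 4 * e * (ν * e + ν * g) ^ 3) := by ring
      _ ≤ 144 ^ 2 * (K : ℝ) ^ 6 * ((e + ν * g) ^ 4 * (e + ν * g) * (e + ν * g) ^ 3) := by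
          gcongr
      _ = (144 ^ 2 * (K : ℝ) ^ 6) * (e + ν * g) ^ 8 := by ring
      _ ≤ (4 ^ 8 * ((K : ℝ) + 1) ^ 8) * (e + ν * g) ^ 8 := by
          apply mul_le_mul_of_nonneg_right _ (by positivity)
          calc (144 : ℝ) ^ 2 * (K : ℝ) ^ 6 ≤ 144 ^ 2 * ((K : ℝ) + 1) ^ 8 :=
                mul_le_mul_of_nonneg_left hK6 (by norm_num)
            _ ≤ 4 ^ 8 * ((K : ℝ) + 1) ^ 8 := mul_le_mul_of_nonneg_right (by norm_num) (by positivity)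
      _ = (4 * ((K : ℝ) + 1) * (ν * g + e)) ^ 8 := by ring
  exact le_of_pow_le_pow_left₀ (by norm_num) (by positivity) hmain

end Summit.AnomalousDissipation.AnomalousDissipation.Theorems.KolmogorovPincerKnownGradeRungTGTools
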